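import Summits.AtomisticToContinuum.Crystallization.Theorems.ChargedEnergyGapRotationGaugeA
import HarnessLib

/-!
# «RotationGauge» P-I(1/2) (lens-3 g61) — part 2 of 2 (sequel of `…ChargedEnergyGapRotationGaugeA`)

Split for the 400-line cap by the landing lane (hand-2 g31); the module docstring of part 1 (`…ChargedEnergyGapRotationGaugeA`) describes the whole node.  Same namespace; all FQNs unchanged.
0 sorry; standard axioms.
-/

noncomputable section
open scoped Classical
open Literature.MathematicalPhysics.StatisticalMechanics
open Literature.Geometry.DiscreteGeometry
open Summit.AtomisticToContinuum.Crystallization.Theses.PricedLinkCensus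
open Summit.AtomisticToContinuum.Crystallization.Theorems.ChargedEnergyGapNegative

namespace Summit.AtomisticToContinuum.Crystallization.Theorems.ChargedEnergyGapChartDial

/-! ## §2 The alarm: `HarmStableWith μ₀` is contradictory at `μ₀ > 0`; the (H)-tower is vacuously true; the reductions collapse to the leaf -/

section Alarm

variable {P : PeriodicConfiguration 3}

/-- ★★★ **THE ALARM.**  At a stress-free reference with one bond of length `≤ 2`, the typed stability hypothesis `HarmStableWith μ₀ P` forces
`μ₀ ≤ 0`: it tests ROTATION cocycles (`isGlobalCocycle_rotField`), on which the cell's quadratic energy vanishes (`sum_quadSite_rotField_eq_zero`)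
while its Dirichlet energy does not (`norm_sq_le_sum_dirichletSite_rotField`, `exists_rotField_single_ne_zero`). -/
theorem harmStableWith_nonpos {μ₀ : ℝ} (hS : IsStressFree P) (h : HarmStableWith μ₀ P)
    (hb : ∃ y ∈ P.motif, ∃ z ∈ P.points, z ≠ y ∧ dist y z ≤ 2) : μ₀ ≤ 0 := by
  obtain ⟨y₀, hy₀, z₀, hz₀, hne, hd⟩ := hb
  obtain ⟨i, hi⟩ := exists_rotField_single_ne_zero hne
  set β := rotField (z₀ - y₀) (EuclideanSpace.single i 1) with hβ
  have hq : ∑ y ∈ P.motif, quadSite β P ∅ y = 0 := sum_quadSite_rotField_eq_zero hS _ _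
  have hD : 0 < ∑ y ∈ P.motif, dirichletSite β P y :=
    lt_of_lt_of_le (by positivity) (norm_sq_le_sum_dirichletSite_rotField (z₀ - y₀) (EuclideanSpace.single i 1) hy₀ hz₀ hne hd)
  have key := h β (isGlobalCocycle_rotField P _ _)
  rw [hq] at key
  by_contra hμ
  push Not at hμ
  linarith [mul_pos hμ hD]

/-- … so at any `μ₀ > 0` the hypotheses «stress-free, stable with margin `μ₀`, one bond `≤ 2`» are CONTRADICTORY. -/
theorem not_harmStableWith {μ₀ : ℝ} (hμ : 0 < μ₀) (hS : IsStressFree P)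
    (hb : ∃ y ∈ P.motif, ∃ z ∈ P.points, z ≠ y ∧ dist y z ≤ 2) : ¬ HarmStableWith μ₀ P :=
  fun h => absurd (harmStableWith_nonpos hS h hb) (not_le.2 hμ)

/-- Every point of a Barlow image has another image point within `11/10` (its in-layer neighbour `(k, i+1, j)`, at distance `a ≤ 11/10`). -/
theorem IsBarlowImage.exists_near {S : Set E3} (hS : IsBarlowImage S) {x₀ : E3} (hx₀ : x₀ ∈ S) :
    ∃ x ∈ S, x ≠ x₀ ∧ dist x x₀ ≤ 11 / 10 := by
  obtain ⟨a, h, s, g, ha, hh, _, hg, rfl⟩ := hS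
  obtain ⟨p₀, hp₀, rfl⟩ := hx₀
  obtain ⟨k, i, j, rfl⟩ := hp₀
  have hd : dist (g (barlowPos a h s k (i + 1) j)) (g (barlowPos a h s k i j)) = a := by
    rw [hg.dist_eq]
    have h2 := dist_barlowPos_sq a h s k (i + 1) j k i j
    push_cast at h2
    have hsq : dist (barlowPos a h s k (i + 1) j) (barlowPos a h s k i j) ^ 2 = a ^ 2 := by rw [h2]; ring
    exact (pow_left_inj₀ dist_nonneg (by linarith [ha.1]) two_ne_zero).1 hsq
  refine ⟨g (barlowPos a h s k (i + 1) j), ⟨_, barlowPos_mem k (i + 1) j, rfl⟩, fun heq => ?_, ?_⟩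
  · rw [heq, dist_self] at hd
    linarith [ha.1]
  · rw [hd]
    exact ha.2

/-- ★ A point Barlow-labelled within `ℓ ≥ 11/10` at strain `lam ≤ 9/11` has a configuration point at distance `≤ (1 + lam)·11/10 ≤ 2`
(distinct from it: `(1 − lam)`-bi-Lipschitz below, `dist_labels_le`). -/
theorem LabelledWithin.exists_short_bond {lam ℓ : ℝ} {Q : PeriodicConfiguration 3} {p : E3} (h : LabelledWithin lam ℓ Q p)
    (hlam : lam ≤ 9 / 11) (hℓ : 11 / 10 ≤ ℓ) : ∃ z ∈ Q.points, z ≠ p ∧ dist p z ≤ 2 := by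
  obtain ⟨S, hS, Φ, x₀, hx₀, hp, hlab, -, hstr⟩ := h
  obtain ⟨x, hx, hne, hd⟩ := hS.exists_near hx₀
  have hxℓ : dist x x₀ ≤ ℓ := hd.trans hℓ
  have h0ℓ : dist x₀ x₀ ≤ ℓ := by rw [dist_self]; linarith
  have hs := hstr x hx x₀ hx₀ hxℓ h0ℓ
  have hxx : ‖x - x₀‖ ≤ 11 / 10 := by rwa [← dist_eq_norm]
  refine ⟨Φ x, hlab x hx hxℓ, fun heq => ?_, ?_⟩
  · have h1 := dist_labels_le hs
    rw [heq, hp, sub_self, norm_zero] at h1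
    have : 0 < (1 - lam) * ‖x - x₀‖ := mul_pos (by linarith) (norm_pos_iff.2 (sub_ne_zero.2 hne))
    linarith
  · rw [hp] at hs
    have h2 := norm_add_le ((Φ x - p) - (x - x₀)) (x - x₀)
    rw [sub_add_cancel] at h2
    rw [dist_comm, dist_eq_norm]
    nlinarith [norm_nonneg (x - x₀)]

/-- ★ Every Barlow-labelled reference (`lam ≤ 9/11`, `ℓ ≥ 11/10`; the record has `lam = 1/3`, `ℓ = 3`) has a motif site with a bond `≤ 2`. -/
theorem IsLabelledRef.exists_short_bond {lam ℓ : ℝ} (h : IsLabelledRef lam ℓ P) (hlam : lam ≤ 9 / 11) (hℓ : 11 / 10 ≤ ℓ) :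
    ∃ y ∈ P.motif, ∃ z ∈ P.points, z ≠ y ∧ dist y z ≤ 2 := by
  obtain ⟨y, hy⟩ := P.motif_nonempty
  obtain ⟨z, hz, hne, hd⟩ := (h y hy).exists_short_bond hlam hℓ
  exact ⟨y, hy, z, hz, hne, hd⟩

/-- ★★ Hence the hypothesis block of every transfer bound of the tower is contradictory at `μ₀ > 0`. -/
theorem labelled_stress_stable_absurd {lam ℓ μ₀ : ℝ} (hμ : 0 < μ₀) (hlam : lam ≤ 9 / 11) (hℓ : 11 / 10 ≤ ℓ)
    (h2 : IsLabelledRef lam ℓ P) (h4 : IsStressFree P) (h5 : HarmStableWith μ₀ P) : False :=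
  not_harmStableWith hμ h4 (h2.exists_short_bond hlam hℓ) h5

variable {s lam ℓ μ₀ τ lamQ ϱ b₀ r_S C_T ϱχ Cχ : ℝ}

/-- ★★★ **(H♭) PROVED FOR THE WRONG REASON** (`C_H := 0`): the harmonic transfer bound for global cocycles holds VACUOUSLY at every `μ₀ > 0`,
`lam ≤ 9/11`, `ℓ ≥ 11/10` — in particular at the record. -/
theorem harmonicTransferBoundC_of_pos (hμ : 0 < μ₀) (hlam : lam ≤ 9 / 11) (hℓ : 11 / 10 ≤ ℓ) :
    HarmonicTransferBoundC s lam ℓ μ₀ τ lamQ ϱ C_T :=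
  ⟨0, le_rfl, fun _ _ _ _ _ h2 _ h4 h5 _ _ _ _ => (labelled_stress_stable_absurd hμ hlam hℓ h2 h4 h5).elim⟩

/-- … hence (H) (the census kill path of record for displacement fields) is vacuously true too. -/
theorem harmonicTransferBound_of_pos (hμ : 0 < μ₀) (hlam : lam ≤ 9 / 11) (hℓ : 11 / 10 ≤ ℓ) :
    HarmonicTransferBound s lam ℓ μ₀ τ lamQ ϱ C_T :=
  harmonicTransferBound_of_cocycle (harmonicTransferBoundC_of_pos hμ hlam hℓ)

/-- ★★★ (H♯) VOLTERRA-TRANSFER, vacuously. -/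
theorem volterraTransferBoundC_of_pos (hμ : 0 < μ₀) (hlam : lam ≤ 9 / 11) (hℓ : 11 / 10 ≤ ℓ) :
    VolterraTransferBoundC s lam ℓ μ₀ τ lamQ ϱ r_S C_T :=
  ⟨0, le_rfl, fun _ _ _ _ _ _ _ h2 _ h4 h5 _ _ _ _ _ => (labelled_stress_stable_absurd hμ hlam hℓ h2 h4 h5).elim⟩

/-- ★★★ (Hˢ) SEAM-TRANSFER, vacuously. -/
theorem seamTransferBoundC_of_pos (hμ : 0 < μ₀) (hlam : lam ≤ 9 / 11) (hℓ : 11 / 10 ≤ ℓ) :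
    SeamTransferBoundC s lam ℓ μ₀ τ lamQ ϱ b₀ r_S C_T :=
  ⟨0, le_rfl, fun _ _ _ _ _ _ _ h2 _ h4 h5 _ _ _ _ _ => (labelled_stress_stable_absurd hμ hlam hℓ h2 h4 h5).elim⟩

/-- ★★★ (H𝄪) LOCAL-TRANSFER — the record's open transfer piece — vacuously. -/
theorem localSeamTransferBoundC_of_pos (hμ : 0 < μ₀) (hlam : lam ≤ 9 / 11) (hℓ : 11 / 10 ≤ ℓ) :
    LocalSeamTransferBoundC s lam ℓ μ₀ τ lamQ ϱ b₀ r_S C_T ϱχ Cχ :=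
  ⟨0, le_rfl, fun _ _ _ _ _ _ _ _ _ _ h2 _ h4 h5 _ _ _ _ _ _ => (labelled_stress_stable_absurd hμ hlam hℓ h2 h4 h5).elim⟩

/-- ★★★ AT THE RECORD DIALS `(s, lam, ℓ, μ₀, τ, λ, b₀, r_S, C_T, ϱχ, Cχ) = (3/5, 1/3, 3, 1/100, 3/100, 1/2, 2/5, 3, 1/(3·10⁶), 80, 10⁻⁵)`, every `ϱ`:
the «open» transfer piece of the record cone (TREE GEN 56L) is a THEOREM — for the wrong reason. -/
theorem localSeamTransferBoundC_record (ϱ : ℝ) :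
    LocalSeamTransferBoundC (3 / 5) (1 / 3) 3 (1 / 100) (3 / 100) (1 / 2) ϱ (2 / 5) 3 (1 / 3000000) 80 (1 / 100000) :=
  localSeamTransferBoundC_of_pos (by norm_num) (by norm_num) (by norm_num)

variable {θ ε R r η L δ L' : ℝ} {W : CoreWeights θ ε R r η L δ L' ϱ} {c₁ ρ₀ B₀ : ℝ}

/-- ★★★ **THE COLLAPSE.**  At `μ₀ > 0`, `lam ≤ 9/11`, `ℓ ≥ 11/10` the localised seam reduction (N𝄪) IS the budget far leaf: the bridge split
`(H𝄪) ∧ ((H𝄪) → leaf)` of generation 56 (and 53–55 below) is `True ∧ (True → leaf)`. -/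
theorem localSeamReductionW_iff_leaf (hμ : 0 < μ₀) (hlam : lam ≤ 9 / 11) (hℓ : 11 / 10 ≤ ℓ) :
    LocalSeamReductionW s lam ℓ μ₀ τ lamQ ϱ b₀ r_S C_T ϱχ Cχ W c₁ ρ₀ B₀ ↔ FarLabelledFloorCoredBudgetW W c₁ s ρ₀ lam ℓ B₀ :=
  ⟨fun h => h (localSeamTransferBoundC_of_pos hμ hlam hℓ), localSeamReductionW_of_budget⟩

/-- (Nˢ) ⟺ leaf. -/
theorem seamReductionW_iff_leaf (hμ : 0 < μ₀) (hlam : lam ≤ 9 / 11) (hℓ : 11 / 10 ≤ ℓ) :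
    SeamReductionW s lam ℓ μ₀ τ lamQ ϱ b₀ r_S C_T W c₁ ρ₀ B₀ ↔ FarLabelledFloorCoredBudgetW W c₁ s ρ₀ lam ℓ B₀ :=
  ⟨fun h => h (seamTransferBoundC_of_pos hμ hlam hℓ), seamReductionW_of_budget⟩

/-- (N♯) ⟺ leaf. -/
theorem volterraReductionW_iff_leaf (hμ : 0 < μ₀) (hlam : lam ≤ 9 / 11) (hℓ : 11 / 10 ≤ ℓ) :
    VolterraReductionW s lam ℓ μ₀ τ lamQ ϱ r_S C_T W c₁ ρ₀ B₀ ↔ FarLabelledFloorCoredBudgetW W c₁ s ρ₀ lam ℓ B₀ :=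
  ⟨fun h => h (volterraTransferBoundC_of_pos hμ hlam hℓ), volterraReductionW_of_budget⟩

/-- (N♭) ⟺ leaf. -/
theorem harmonicReductionW_iff_leaf (hμ : 0 < μ₀) (hlam : lam ≤ 9 / 11) (hℓ : 11 / 10 ≤ ℓ) :
    HarmonicReductionW s lam ℓ μ₀ τ lamQ ϱ C_T W c₁ ρ₀ B₀ ↔ FarLabelledFloorCoredBudgetW W c₁ s ρ₀ lam ℓ B₀ :=
  ⟨fun h => h (harmonicTransferBoundC_of_pos hμ hlam hℓ), harmonicReductionW_of_budget⟩

/-- ★★ The record's open pair `(H𝄪) ∧ (N𝄪)` at `ϱ = 160` is ONE statement, the GEN-52 budget far leaf for the max-cover weights. -/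
theorem localSeamReductionW_record_iff_leaf :
    LocalSeamReductionW (3 / 5) (1 / 3) 3 (1 / 100) (3 / 100) (1 / 2) 160 (2 / 5) 3 (1 / 3000000) 80 (1 / 100000)
        (maxCoverWeights (3 / 20) (1 / 10) (6 / 5) 10 (1 / 100) 40 (1 / 10) 40 160) (1 / 20) 10 100000 ↔
      FarLabelledFloorCoredBudgetW (maxCoverWeights (3 / 20) (1 / 10) (6 / 5) 10 (1 / 100) 40 (1 / 10) 40 160) (1 / 20) (3 / 5) 10
        (1 / 3) 3 100000 :=
  localSeamReductionW_iff_leaf (by norm_num) (by norm_num) (by norm_num)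

/-- ★★ … so the TEN-leaf record cone of TREE GEN 56L is the NINE-leaf cone of GEN 52 (`chargedEnergyGap_of_maxCoverBudgetLedger_record`) with
(H𝄪) discharged: nothing was gained by generations 53–56 AS TYPED. -/
theorem chargedEnergyGap_of_maxCoverLocalLedger_collapsed (hF : ChargeRecount)
    (hIP : ImprovablePricingG (3 / 20) (1 / 10) (6 / 5) 10 (1 / 100) (3 / 5))
    (hFCP : FrustratedCorePricingG (3 / 20) (1 / 10) (6 / 5) 10 (1 / 100) 40 (3 / 5))
    (hCCP : CoherentCorePricingG (3 / 20) (1 / 10) (6 / 5) 10 (1 / 100) 40 (1 / 10) 40 (3 / 5))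
    (hB : CoreBallRegularPricingW (maxCoverWeights (3 / 20) (1 / 10) (6 / 5) 10 (1 / 100) 40 (1 / 10) 40 160) (1 / 20) (3 / 5) 10
      fun _ _ => True)
    (hLab : CleanLabellingW (maxCoverWeights (3 / 20) (1 / 10) (6 / 5) 10 (1 / 100) 40 (1 / 10) 40 160) (3 / 5) 10 (1 / 3) 3)
    (hSB : ShellBudgetW (maxCoverWeights (3 / 20) (1 / 10) (6 / 5) 10 (1 / 100) 40 (1 / 10) 40 160) (3 / 5) 100000)
    (hN : LocalSeamReductionW (3 / 5) (1 / 3) 3 (1 / 100) (3 / 100) (1 / 2) 160 (2 / 5) 3 (1 / 3000000) 80 (1 / 100000)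
      (maxCoverWeights (3 / 20) (1 / 10) (6 / 5) 10 (1 / 100) 40 (1 / 10) 40 160) (1 / 20) 10 100000)
    (hP : ChartedChargePricingG (3 / 20) (1 / 10) (3 / 5)) : ChargedEnergyGap :=
  chargedEnergyGap_of_maxCoverLocalLedger_record hF hIP hFCP hCCP hB hLab hSB (localSeamTransferBoundC_record 160) hN hP

end Alarm

end Summit.AtomisticToContinuum.Crystallization.Theorems.ChargedEnergyGapChartDial

end
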